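import Literature.AlgebraicGeometry.HodgeTheory.AtiyahClassTraceReal
import Mathlib.Algebra.Homology.DerivedCategory.Ext.Map
import HarnessLib

/-!
# Conjugation invariance of the trace and naturality of the Atiyah class

PROMOTED LITERATURE COPY (librarian protocol (b); DEFREQ-CoherentISemiregular, cell pub-hsemireg) of the generic, conjecture-free
`Summits/HodgeConjecture/HodgeConjecture/Theorems/PadicSemiregularLiftPadicPridhamSemiregularityTraceConjugation.lean` — namespace now `Literature.AlgebraicGeometry.HodgeTheory`, names kept; cell words (seats, ventures) = provenance.

(Born as the helper file of a route stub — `{0,1}`-semiregularity of a finite locally free module, injectivity of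
`(σ₀, σ₁) = (Tr, Tr_{Ω¹}(− ∘ At))` on `Ext²(E, E)` (`HodgeTheory/AtiyahClassTraceReal.lean`), passes along an isomorphism
`e : E ≅ E'`; the route-registration theorem `stub_trace_app_conj` of the original is NOT copied.) The content is the
naturality of the real `σ₀`, `σ₁` under conjugation `x' ↦ e ≫ x' ≫ e⁻¹`, which rests on three facts proved HERE (assembled in
the companion file `ZeroOneSemiregularOfIso.lean`):

1. `Ext.mk₀_comp_mapExactFunctor_of_natIso` — **`Ext.mapExactFunctor` is natural in the exact functor**:
   for an isomorphism `τ : F ≅ G` of exact functors between abelian categories and `x ∈ Extⁿ(X, Y)`,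
   `τ_X ≫ G(x) = F(x) ≫ τ_Y`. Mathlib (pin v4.32.0) relates `mapExactFunctor` to `mk₀`/`comp`/`extClass`
   for ONE functor only; the two-functor square is read off `LocalizerMorphism.equiv_smallShiftedHomMap`,
   which computes `F` on small `Ext` through ANY shift-compatible lift to the derived categories — here
   the lift `G.mapDerivedCategory` twisted by `NatIso.mapHomologicalComplex τ` (shift-compatible on the
   nose) — leaving the naturality of `Functor.mapCochainComplexSingleFunctor` in the functor.
2. `sheafHomPrecomp g M : 𝓗om(E₂, M) → 𝓗om(E₁, M)` (first-variable functoriality of the internal Hom of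
   `Modules/SheafHomFunctor.lean`), `sheafHomFunctorIso e : 𝓗om(E', –) ≅ 𝓗om(E, –)`, and the
   **conjugation invariance of the unit, the trace and the contraction** of `Modules/LocallyFreeTrace.lean`
   (`sheafHomUnit_conj`, `trace_conj : tr_E(e ψ e⁻¹) = tr_{E'}(ψ)`, `contract_conj`), proved on the framed
   opens of `E` (`hom_ext_of_frames`) by transporting a frame `b_i` of `E` to the frame `e b_i` of `E'`.
3. `jetMap g : P¹(E₁) → P¹(E₂)`, `(s, φ) ↦ (g s, (g ⊗ 1) φ)` — **functoriality of Atiyah's jet module**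
   (`𝒪`-linear for the twisted structures since `(g ⊗ 1) δ(a, s) = δ(a, g s)`), hence a morphism of Atiyah
   sequences and, by Mathlib's `ShortExact.extClass_naturality`, **naturality of the Atiyah class**
   `At(E₁) ≫ (g ⊗ 1) = g ≫ At(E₂)` (`atiyahClass_naturality`; Atiyah 1957 Prop. 6–7; "Not here:
   functoriality of `P¹`" in `HodgeTheory/AtiyahClass.lean`).

## References

* M. F. Atiyah, *Complex analytic connections in fibre bundles*, Trans. AMS 85 (1957), §4, Prop. 6–7. [Atiyah1957]
* R. Hartshorne, *Algebraic Geometry* (1977), II.5, II Ex. 1.15, II Ex. 5.1. [Hartshorne1977]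
* R.-O. Buchweitz, H. Flenner, Compositio Math. 137 (2003), §4 (trace maps). [BuchweitzFlenner2003]
-/

noncomputable section

open CategoryTheory CategoryTheory.Limits CategoryTheory.Abelian AlgebraicGeometry Opposite TopologicalSpace
  Literature.AlgebraicGeometry.Motives Literature.AlgebraicGeometry.HodgeTheory Literature.AlgebraicGeometry.Modules

universe w w' v v' u u' u''

namespace Literature.AlgebraicGeometry.HodgeTheory

/-! ### Naturality of `Ext.mapExactFunctor` in the exact functor -/

section ExtNaturality

variable {C : Type u'} [Category.{v} C] [Abelian C] {D : Type u''} [Category.{v'} D] [Abelian D]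
  (F G : C ⥤ D) [F.Additive] [G.Additive]

set_option backward.isDefEq.respectTransparency false in
/-- The natural transformation induced on cochain complexes by `τ : F ⟶ G` commutes with the shifts
(all the commutation isomorphisms are identities). [cite: Weibel1994, Def. 10.2.1 and §10.7 (translation functor; Ext and RHom)] -/
lemma commShift_mapHomologicalComplex (τ : F ⟶ G) :
    NatTrans.CommShift (NatTrans.mapHomologicalComplex τ (ComplexShape.up ℤ)) ℤ where
  shift_comm n := by
    ext K i
    simp

set_option backward.isDefEq.respectTransparency false in
/-- The comparison `F(X)[0] ≅ F(X[0])` (`Functor.mapCochainComplexSingleFunctor`) is natural in the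
functor `F`. [cite: Weibel1994, Def. 10.2.1 and §10.7 (translation functor; Ext and RHom)] -/
lemma mapCochainComplexSingleFunctor_hom_app_naturality (τ : F ⟶ G) (X : C) :
    (NatTrans.mapHomologicalComplex τ (ComplexShape.up ℤ)).app
        ((CochainComplex.singleFunctor C 0).obj X) ≫ (G.mapCochainComplexSingleFunctor 0).hom.app X =
      (F.mapCochainComplexSingleFunctor 0).hom.app X ≫
        (CochainComplex.singleFunctor D 0).map (τ.app X) := by
  apply HomologicalComplex.to_single_hom_ext
  simp only [Functor.mapCochainComplexSingleFunctor, CochainComplex.singleFunctor,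
    CochainComplex.singleFunctors, HomologicalComplex.comp_f, NatTrans.mapHomologicalComplex_app_f,
    HomologicalComplex.singleMapHomologicalComplex_hom_app_self, HomologicalComplex.single_map_f_self,
    Category.assoc, Iso.inv_hom_id_assoc, NatTrans.naturality_assoc]

variable [PreservesFiniteLimits F] [PreservesFiniteColimits F]
  [PreservesFiniteLimits G] [PreservesFiniteColimits G]

set_option backward.isDefEq.respectTransparency false in
/-- **`Ext.mapExactFunctor` is natural in the exact functor**: for an isomorphism `τ : F ≅ G` of
exact functors between abelian categories and `x ∈ Extⁿ(X, Y)`,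
`τ_X ≫ G(x) = F(x) ≫ τ_Y` in `Extⁿ(F X, G Y)`. (Mathlib has `mapExactFunctor_comp`/`_mk₀`/`_extClass`
for ONE functor; this two-functor compatibility is read off `LocalizerMorphism.equiv_smallShiftedHomMap`,
which describes `F`'s action through ANY lift of `F` to the derived categories — here the lift
`G.mapDerivedCategory`, twisted by `τ`.) [cite: Weibel1994, Def. 10.2.1 and §10.7 (translation functor; Ext and RHom)] -/
theorem Ext.mk₀_comp_mapExactFunctor_of_natIso [HasExt.{w} C] [HasExt.{w'} D]
    (τ : F ≅ G) {X Y : C} {n : ℕ} (x : Ext X Y n) :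
    (Ext.mk₀ (τ.hom.app X)).comp (x.mapExactFunctor G) (zero_add n) =
      (x.mapExactFunctor F).comp (Ext.mk₀ (τ.hom.app Y)) (add_zero n) := by
  letI := HasDerivedCategory.standard C
  letI := HasDerivedCategory.standard D
  let e' : F.mapHomologicalComplex (ComplexShape.up ℤ) ⋙ DerivedCategory.Q ≅
      DerivedCategory.Q ⋙ G.mapDerivedCategory :=
    Functor.isoWhiskerRight (NatIso.mapHomologicalComplex τ (ComplexShape.up ℤ)) DerivedCategory.Q ≪≫
      G.mapDerivedCategoryFactors.symm
  haveI := commShift_mapHomologicalComplex F G τ.hom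
  haveI : NatTrans.CommShift e'.hom ℤ := by
    change NatTrans.CommShift (Functor.whiskerRight (NatTrans.mapHomologicalComplex τ.hom _) _ ≫
      G.mapDerivedCategoryFactors.inv) ℤ
    infer_instance
  have hF : (x.mapExactFunctor F).hom = _ :=
    (F.mapHomologicalComplexUpToQuasiIsoLocalizerMorphism (ComplexShape.up ℤ)).equiv_smallShiftedHomMap
      DerivedCategory.Q DerivedCategory.Q ((F.mapCochainComplexSingleFunctor 0).app X)
      ((F.mapCochainComplexSingleFunctor 0).app Y) G.mapDerivedCategory e' x
  have hG : (x.mapExactFunctor G).hom = _ :=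
    (G.mapHomologicalComplexUpToQuasiIsoLocalizerMorphism (ComplexShape.up ℤ)).equiv_smallShiftedHomMap
      DerivedCategory.Q DerivedCategory.Q ((G.mapCochainComplexSingleFunctor 0).app X)
      ((G.mapCochainComplexSingleFunctor 0).app Y) G.mapDerivedCategory G.mapDerivedCategoryFactors.symm x
  have ha : (DerivedCategory.singleFunctor D 0).map (τ.hom.app X) ≫
      DerivedCategory.Q.map ((G.mapCochainComplexSingleFunctor 0).app X).inv =
        DerivedCategory.Q.map ((F.mapCochainComplexSingleFunctor 0).app X).inv ≫
          DerivedCategory.Q.map ((NatIso.mapHomologicalComplex τ (ComplexShape.up ℤ)).hom.app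
            ((CochainComplex.singleFunctor C 0).obj X)) := by
    change DerivedCategory.Q.map ((CochainComplex.singleFunctor D 0).map (τ.hom.app X)) ≫ _ = _
    rw [← Functor.map_comp, ← Functor.map_comp]
    congr 1
    rw [Iso.comp_inv_eq, Category.assoc, Iso.eq_inv_comp]
    exact (mapCochainComplexSingleFunctor_hom_app_naturality F G τ.hom X).symm
  have hb : DerivedCategory.Q.map ((NatIso.mapHomologicalComplex τ (ComplexShape.up ℤ)).inv.app
      ((CochainComplex.singleFunctor C 0).obj Y)) ≫
        DerivedCategory.Q.map ((F.mapCochainComplexSingleFunctor 0).app Y).hom ≫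
          (DerivedCategory.singleFunctor D 0).map (τ.hom.app Y) =
      DerivedCategory.Q.map ((G.mapCochainComplexSingleFunctor 0).app Y).hom := by
    change _ ≫ _ ≫ DerivedCategory.Q.map ((CochainComplex.singleFunctor D 0).map (τ.hom.app Y)) = _
    rw [← Functor.map_comp, ← Functor.map_comp]
    congr 1
    rw [← Iso.app_inv, Iso.inv_comp_eq, Iso.app_hom]
    exact (mapCochainComplexSingleFunctor_hom_app_naturality F G τ.hom Y).symm
  apply Ext.ext
  rw [Ext.comp_hom, Ext.comp_hom, hF, hG, Ext.mk₀_hom, Ext.mk₀_hom]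
  simp only [ShiftedHom.comp_mk₀, ShiftedHom.mk₀_comp, Category.assoc, Functor.map_comp, Iso.trans_hom,
    Iso.trans_inv, Iso.symm_hom, Iso.symm_inv, NatTrans.comp_app,
    Functor.isoWhiskerRight_hom, Functor.isoWhiskerRight_inv, Functor.whiskerRight_app, e']
  rw [reassoc_of% ha, ← hb]
  simp only [Functor.map_comp]

end ExtNaturality

section Precomp

variable {X : Scheme.{u}} {E₁ E₂ E₃ : X.Modules}

/-- **Pre-composition** with `g : E₁ → E₂`: the morphism `𝓗om(E₂, M) → 𝓗om(E₁, M)`,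
`φ ↦ g|_U ≫ φ` on sections over `U` (functoriality of `𝓗om(–, M)` in the first variable).
[cite: Hartshorne1977, II Ex. 1.15 and II.5 p. 109] -/
def sheafHomPrecomp (g : E₁ ⟶ E₂) (M : X.Modules) : sheafHom E₂ M ⟶ sheafHom E₁ M where
  val := PresheafOfModules.homMk
    { app := fun U => AddCommGrpCat.ofHom
        { toFun := fun φ : E₂.over U.unop ⟶ M.over U.unop =>
            (SheafOfModules.overFunctor _ U.unop).map g ≫ φ
          map_zero' := comp_zero
          map_add' := fun φ ψ => Preadditive.comp_add _ _ _ _ φ ψ }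
      naturality := fun {U V} i => by
        refine AddCommGrpCat.ext fun (φ : E₂.over U.unop ⟶ M.over U.unop) => ?_
        change (SheafOfModules.overFunctor _ V.unop).map g ≫ restrictHom i.unop φ =
          restrictHom i.unop ((SheafOfModules.overFunctor _ U.unop).map g ≫ φ)
        rw [restrictHom_comp, restrictHom_over_map] }
    (fun U (a : Γ(X, U.unop)) (φ : E₂.over U.unop ⟶ M.over U.unop) => by
      change (SheafOfModules.overFunctor _ U.unop).map g ≫ (a • φ) =
        a • ((SheafOfModules.overFunctor _ U.unop).map g ≫ φ)
      rw [smul_overHom_def, smul_overHom_def, Category.assoc])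

/-- Sections of `sheafHomPrecomp g M`: `φ ↦ g|_U ≫ φ`. [cite: Hartshorne1977, II §5 (sheaf Hom, p. 109)] -/
@[simp]
lemma sheafHomPrecomp_app_apply (g : E₁ ⟶ E₂) (M : X.Modules) (U : X.Opens)
    (φ : E₂.over U ⟶ M.over U) :
    (sheafHomPrecomp g M).app U φ = (SheafOfModules.overFunctor _ U).map g ≫ φ := rfl

/-- `e (e⁻¹ s) = s` on sections. [cite: Hartshorne1977, II §5 (sheaf Hom, p. 109)] -/
lemma app_inv_app_apply (e : E₁ ≅ E₂) (W : X.Opens) (s : Γ(E₂, W)) :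
    e.hom.app W (e.inv.app W s) = s := by
  change (e.inv.app W ≫ e.hom.app W) s = s
  rw [← Scheme.Modules.Hom.comp_app, e.inv_hom_id, Scheme.Modules.Hom.id_app]
  rfl

/-- `𝓗om(𝟙, M) = 𝟙`. [cite: Hartshorne1977, II §5 (sheaf Hom, p. 109)] -/
@[simp]
lemma sheafHomPrecomp_id (M : X.Modules) : sheafHomPrecomp (𝟙 E₁) M = 𝟙 (sheafHom E₁ M) := by
  refine Scheme.Modules.hom_ext _ _ fun U => AddCommGrpCat.ext fun (φ : E₁.over U ⟶ M.over U) => ?_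
  change (SheafOfModules.overFunctor _ U).map (𝟙 E₁) ≫ φ = φ
  exact hom_ext_of_appLE fun W k s => rfl

/-- `𝓗om(g ≫ g', M) = 𝓗om(g', M) ≫ 𝓗om(g, M)` (contravariance). [cite: Hartshorne1977, II §5 (sheaf Hom, p. 109)] -/
lemma sheafHomPrecomp_comp (g : E₁ ⟶ E₂) (g' : E₂ ⟶ E₃) (M : X.Modules) :
    sheafHomPrecomp (g ≫ g') M = sheafHomPrecomp g' M ≫ sheafHomPrecomp g M := by
  refine Scheme.Modules.hom_ext _ _ fun U => AddCommGrpCat.ext fun (φ : E₃.over U ⟶ M.over U) => ?_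
  change (SheafOfModules.overFunctor _ U).map (g ≫ g') ≫ φ =
    (SheafOfModules.overFunctor _ U).map g ≫ ((SheafOfModules.overFunctor _ U).map g' ≫ φ)
  exact hom_ext_of_appLE fun W k s => rfl

/-- Pre- and post-composition commute: `𝓗om(g, M) ≫ 𝓗om(E₁, f) = 𝓗om(E₂, f) ≫ 𝓗om(g, N)`
(`𝓗om` is a bifunctor). [cite: Hartshorne1977, II §5 (sheaf Hom, p. 109)] -/
lemma sheafHomPrecomp_comp_sheafHomMap (g : E₁ ⟶ E₂) {M N : X.Modules} (f : M ⟶ N) :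
    sheafHomPrecomp g M ≫ sheafHomMap E₁ f = sheafHomMap E₂ f ≫ sheafHomPrecomp g N := by
  refine Scheme.Modules.hom_ext _ _ fun U => AddCommGrpCat.ext fun (φ : E₂.over U ⟶ M.over U) => ?_
  change ((SheafOfModules.overFunctor _ U).map g ≫ φ) ≫ (SheafOfModules.overFunctor _ U).map f =
    (SheafOfModules.overFunctor _ U).map g ≫ (φ ≫ (SheafOfModules.overFunctor _ U).map f)
  rw [Category.assoc]

/-- `𝓗om(e, M) ≫ 𝓗om(e⁻¹, M) = 𝟙` for an isomorphism `e`. [cite: Hartshorne1977, II §5 (sheaf Hom, p. 109)] -/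
lemma sheafHomPrecomp_hom_inv_id (e : E₁ ≅ E₂) (M : X.Modules) :
    sheafHomPrecomp e.hom M ≫ sheafHomPrecomp e.inv M = 𝟙 _ := by
  rw [← sheafHomPrecomp_comp, e.inv_hom_id, sheafHomPrecomp_id]

/-- `𝓗om(e⁻¹, M) ≫ 𝓗om(e, M) = 𝟙` for an isomorphism `e`. [cite: Hartshorne1977, II §5 (sheaf Hom, p. 109)] -/
lemma sheafHomPrecomp_inv_hom_id (e : E₁ ≅ E₂) (M : X.Modules) :
    sheafHomPrecomp e.inv M ≫ sheafHomPrecomp e.hom M = 𝟙 _ := by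
  rw [← sheafHomPrecomp_comp, e.hom_inv_id, sheafHomPrecomp_id]

/-- **`𝓗om(E', –) ≅ 𝓗om(E, –)` for `e : E ≅ E'`**: the natural isomorphism of internal-Hom functors
given by pre-composition with `e` (inverse: pre-composition with `e⁻¹`). [folklore] -/
def sheafHomFunctorIso (e : E₁ ≅ E₂) : sheafHomFunctor E₂ ≅ sheafHomFunctor E₁ :=
  NatIso.ofComponents
    (fun M => { hom := sheafHomPrecomp e.hom M
                inv := sheafHomPrecomp e.inv M
                hom_inv_id := sheafHomPrecomp_hom_inv_id e M
                inv_hom_id := sheafHomPrecomp_inv_hom_id e M })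
    (fun f => (sheafHomPrecomp_comp_sheafHomMap e.hom f).symm)

/-- Components of `sheafHomFunctorIso e`. [cite: Hartshorne1977, II §5 (sheaf Hom, p. 109)] -/
@[simp]
lemma sheafHomFunctorIso_hom_app (e : E₁ ≅ E₂) (M : X.Modules) :
    (sheafHomFunctorIso e).hom.app M = sheafHomPrecomp e.hom M := rfl

/-- **The unit is conjugation-invariant**: `(a ↦ a · 𝟙_E) ≫ (– ≫ e) ≫ (e⁻¹ ≫ –) = (a ↦ a · 𝟙_{E'})`.
[cite: Hartshorne1977, II §5 (sheaf Hom, p. 109)] -/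
lemma sheafHomUnit_conj (e : E₁ ≅ E₂) :
    sheafHomUnit E₁ ≫ sheafHomMap E₁ e.hom ≫ sheafHomPrecomp e.inv E₂ = sheafHomUnit E₂ := by
  refine Scheme.Modules.hom_ext _ _ fun U => AddCommGrpCat.ext fun (a : Γ(X, U)) => ?_
  change (sheafHomPrecomp e.inv E₂).app U ((sheafHomMap E₁ e.hom).app U ((sheafHomUnit E₁).app U a)) =
    (sheafHomUnit E₂).app U a
  rw [sheafHomUnit_app_apply, sheafHomUnit_app_apply, sheafHomMap_app_apply,
    sheafHomPrecomp_app_apply]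
  refine hom_ext_of_appLE fun W k s => ?_
  rw [appLE_comp, appLE_comp, appLE_over_map, appLE_overScalar, appLE_over_map, appLE_overScalar,
    Scheme.Modules.Hom.app_smul, app_inv_app_apply]

end Precomp

/-! ### Locality: morphisms out of `𝓗om` are determined on framed opens -/

section Frames

variable {X : Scheme.{u}} {E E' A M G : X.Modules} {W : X.Opens} {I : Type u}

/-- Two morphisms `𝓗om(A, M) → G` agree as soon as they agree on sections over every open carrying
a finite frame of a finite locally free `E` (such opens cover `X`; `G` is a sheaf). [cite: Hartshorne1977, II Ex. 5.1 (a)–(b)] -/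
theorem hom_ext_of_frames (hE : IsFiniteLocallyFree E) {α β : sheafHom A M ⟶ G}
    (h : ∀ ⦃W : X.Opens⦄ ⦃I : Type u⦄ [Fintype I] (_f : SheafOfModules.free I ≅ E.over W)
      (ψ : A.over W ⟶ M.over W), α.app W ψ = β.app W ψ) : α = β := by
  refine Scheme.Modules.hom_ext _ _ fun U => AddCommGrpCat.ext fun (φ : A.over U ⟶ M.over U) => ?_
  refine TopCat.Sheaf.eq_of_locally_eq' ((SheafOfModules.toSheaf _).obj G)
    (fun x : U => piece hE U x) U (fun x => Opens.infLELeft U (trivNbhd hE x.1)) (le_iSup_piece hE)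
    _ _ fun x => ?_
  change G.presheaf.map (Opens.infLELeft U (trivNbhd hE x.1)).op (α.app U φ) =
    G.presheaf.map (Opens.infLELeft U (trivNbhd hE x.1)).op (β.app U φ)
  rw [← Scheme.Modules.Hom.app_map_apply, ← Scheme.Modules.Hom.app_map_apply]
  exact h (pieceFrame hE x) _

/-- Basis sections of the transported frame `f ≫ e|_W` of `E'`: the images `e b_i`. [cite: Hartshorne1977, II Ex. 5.1 (a)–(b)] -/
lemma basisSection_trans (f : SheafOfModules.free I ≅ E.over W) (e : E ≅ E') (i : I) :
    basisSection (f ≪≫ (SheafOfModules.overFunctor _ W).mapIso e) i = e.hom.app W (basisSection f i) := by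
  rw [basisSection, basisSection, Iso.trans_hom, Functor.mapIso_hom,
    SheafOfModules.freeHomEquiv_comp_apply, overSectionsEquiv_sectionsMap', appLE_over_map]

/-- The dual basis of the transported frame `f ≫ e|_W` of `E'` is `e⁻¹|_W ≫ λ_i`. [cite: Hartshorne1977, II Ex. 5.1 (a)–(b)] -/
lemma dualBasis_trans (f : SheafOfModules.free I ≅ E.over W) (e : E ≅ E') (i : I) :
    dualBasis (f ≪≫ (SheafOfModules.overFunctor _ W).mapIso e) i =
      (SheafOfModules.overFunctor _ W).map e.inv ≫ dualBasis f i :=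
  Category.assoc _ _ _

/-- **The trace is conjugation-invariant**: `tr_E(e ≫ ψ ≫ e⁻¹) = tr_{E'}(ψ)` for `e : E ≅ E'`
(in a frame `b_i` of `E` and the frame `e b_i` of `E'` both are `∑_i λ_i(e⁻¹ ψ e b_i)`). [cite: Hartshorne1977, II Ex. 5.1 (a)–(b)] -/
theorem trace_conj (e : E ≅ E') (hE : IsFiniteLocallyFree E) (hE' : IsFiniteLocallyFree E') :
    sheafHomPrecomp e.hom E' ≫ sheafHomMap E e.inv ≫ trace hE = trace hE' := by
  refine hom_ext_of_frames hE fun W I _ f ψ => ?_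
  change (trace hE).app W ((sheafHomMap E e.inv).app W ((sheafHomPrecomp e.hom E').app W ψ)) = _
  rw [sheafHomPrecomp_app_apply, sheafHomMap_app_apply, trace_app_eq_sum hE f,
    trace_app_eq_sum hE' (f ≪≫ (SheafOfModules.overFunctor _ W).mapIso e)]
  refine Finset.sum_congr rfl fun i _ => ?_
  simp only [basisSection_trans, dualBasis_trans, appLE_comp, appLE_over_map]

/-- The map `E' ⊗ G → E ⊗ G` induced by `g : E' → E` on the models `𝓗om(E'^∨, G) → 𝓗om(E^∨, G)`:
pre-composition with the transpose `g^∨ : E^∨ → E'^∨`. [folklore] -/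
abbrev twistMap (g : E' ⟶ E) (G : X.Modules) : sheafHom (dual E') G ⟶ sheafHom (dual E) G :=
  sheafHomPrecomp (sheafHomPrecomp g (unitModule X)) G

/-- **The contraction is conjugation-invariant**: for `e : E ≅ E'` and any `G`,
`𝓗om(E', 𝓗om(E'^∨, G)) → 𝓗om(E, 𝓗om(E^∨, G)) → G` (conjugate by `e`, then contract for `E`) is the
contraction for `E'`. [cite: Hartshorne1977, II Ex. 5.1 (a)–(b)] -/
theorem contract_conj (e : E ≅ E') (hE : IsFiniteLocallyFree E) (hE' : IsFiniteLocallyFree E')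
    (G : X.Modules) :
    sheafHomPrecomp e.hom (sheafHom (dual E') G) ≫ sheafHomMap E (twistMap e.inv G) ≫ contract hE G =
      contract hE' G := by
  refine hom_ext_of_frames hE fun W I _ f B => ?_
  change (contract hE G).app W ((sheafHomMap E (twistMap e.inv G)).app W
    ((sheafHomPrecomp e.hom _).app W B)) = _
  rw [sheafHomPrecomp_app_apply, sheafHomMap_app_apply, contract_app_eq_frameContract hE G f,
    contract_app_eq_frameContract hE' G (f ≪≫ (SheafOfModules.overFunctor _ W).mapIso e)]
  unfold frameContract
  refine Finset.sum_congr rfl fun i _ => ?_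
  simp only [basisSection_trans, dualBasis_trans, appLE_comp, appLE_over_map, sheafHomPrecomp_app_apply]

end Frames

/-! ### Functoriality of the Atiyah extension and naturality of the Atiyah class -/

section Atiyah

variable {S : Type u} [CommRing S] {X : Over (Spec (CommRingCat.of S))} {E₁ E₂ : X.left.Modules}
  {U : X.left.Opens}

/-- Transposes commute with evaluation: `(g^∨)|_U ≫ ev_s = ev_{g s}` (`s ∈ Γ(E₁, U)`). [cite: Hartshorne1977, II §5 (sheaf Hom, p. 109)] -/
lemma over_map_precomp_comp_evalAt (g : E₁ ⟶ E₂) (s : Γ(E₁, U)) :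
    (SheafOfModules.overFunctor _ U).map (sheafHomPrecomp g (unitModule X.left)) ≫
        evalAt (M := unitModule X.left) s = evalAt (M := unitModule X.left) (g.app U s) := by
  refine hom_ext_of_appLE fun W k (μ : E₂.over W ⟶ (unitModule X.left).over W) => ?_
  rw [appLE_comp, appLE_over_map, appLE_evalAt, sheafHomPrecomp_app_apply, appLE_comp,
    appLE_over_map, appLE_evalAt, Scheme.Modules.Hom.app_map_apply]

/-- The twisting term is natural: `(g ⊗ 1)(δ_{E₁}(a, s)) = δ_{E₂}(a, g s)`. [cite: Atiyah1957, §4 Prop. 6–7] -/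
lemma twistMap_app_deltaHom (g : E₁ ⟶ E₂) (a : Γ(X.left, U)) (s : Γ(E₁, U)) :
    (twistMap g (cotangentSheaf X)).app U (deltaHom E₁ U a s) = deltaHom E₂ U a (g.app U s) := by
  rw [sheafHomPrecomp_app_apply, deltaHom, deltaHom, ← Category.assoc, over_map_precomp_comp_evalAt]

/-- **Functoriality of the jet module** `P¹(E₁) → P¹(E₂)` along `g : E₁ → E₂`: `(s, φ) ↦ (g s, (g ⊗ 1) φ)`;
`𝒪_X`-linear for Atiyah's twisted structures because `(g ⊗ 1) δ(a, s) = δ(a, g s)` (Atiyah 1957,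
Prop. 6: `D` is functorial). [cite: Atiyah1957, §4 Prop. 6] -/
def jetMap (g : E₁ ⟶ E₂) : jetModule E₁ ⟶ jetModule E₂ where
  val := PresheafOfModules.homMk
    { app := fun U => AddCommGrpCat.ofHom
        { toFun := fun p : JetSections E₁ U.unop =>
            (JetSections.mk (g.app U.unop p.fst) ((twistMap g (cotangentSheaf X)).app U.unop p.snd) :
              JetSections E₂ U.unop)
          map_zero' := JetSections.ext (g.app U.unop).hom.map_zero
            ((twistMap g (cotangentSheaf X)).app U.unop).hom.map_zero
          map_add' := fun p q => JetSections.ext ((g.app U.unop).hom.map_add p.fst q.fst)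
            (((twistMap g (cotangentSheaf X)).app U.unop).hom.map_add p.snd q.snd) }
      naturality := fun {U V} i => AddCommGrpCat.ext fun (p : JetSections E₁ U.unop) =>
        JetSections.ext (Scheme.Modules.Hom.app_map_apply g i.unop p.fst)
          (Scheme.Modules.Hom.app_map_apply (twistMap g (cotangentSheaf X)) i.unop p.snd) }
    (fun U (a : Γ(X.left, U.unop)) (p : JetSections E₁ U.unop) =>
      JetSections.ext (Scheme.Modules.Hom.app_smul g a p.fst) (by
        change (SheafOfModules.overFunctor _ U.unop).map (sheafHomPrecomp g (unitModule X.left)) ≫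
            (a • p.snd + deltaHom E₁ U.unop a p.fst) =
          a • ((SheafOfModules.overFunctor _ U.unop).map (sheafHomPrecomp g (unitModule X.left)) ≫
            p.snd) + deltaHom E₂ U.unop a (g.app U.unop p.fst)
        rw [Preadditive.comp_add, smul_overHom_def, smul_overHom_def, ← Category.assoc,
          ← twistMap_app_deltaHom, sheafHomPrecomp_app_apply]))

variable [HasExt.{w} X.left.Modules]

/-- **Naturality of the Atiyah class** (Atiyah 1957, Prop. 7): for `g : E₁ → E₂`,
`At(E₁) ≫ (g ⊗ 1) = g ≫ At(E₂)` in `Ext¹(E₁, E₂ ⊗ Ω¹)` — `(g ⊗ 1, P¹(g), g)` is a morphism of Atiyah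
sequences, and `ShortExact.extClass` is natural (Mathlib). [cite: Atiyah1957, §4 Prop. 7] -/
theorem atiyahClass_naturality (g : E₁ ⟶ E₂) :
    (atiyahClass E₁).comp (Ext.mk₀ (twistMap g (cotangentSheaf X))) (add_zero 1) =
      (Ext.mk₀ g).comp (atiyahClass E₂) (zero_add 1) :=
  (jetShortComplex_shortExact E₁).extClass_naturality (jetShortComplex_shortExact E₂)
    { τ₁ := twistMap g (cotangentSheaf X)
      τ₂ := jetMap g
      τ₃ := g
      comm₁₂ := Scheme.Modules.hom_ext _ _ fun U => AddCommGrpCat.ext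
        fun (_ : (dual E₁).over U ⟶ (cotangentSheaf X).over U) =>
          JetSections.ext ((g.app U).hom.map_zero).symm rfl
      comm₂₃ := Scheme.Modules.hom_ext _ _ fun U => AddCommGrpCat.ext fun (_ : JetSections E₁ U) => rfl }

end Atiyah

end Literature.AlgebraicGeometry.HodgeTheory

end
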